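import Literature.NumberTheory.LFunctions.SuzukiStructureFunctions
import Literature.NumberTheory.LFunctions.RiemannXiPrimitiveProofs
import Literature.NumberTheory.LFunctions.RiemannXiProofs
import Literature.NumberTheory.LFunctions.XiIntegralUniformProofs
import Literature.NumberTheory.LFunctions.SuzukiSingleOperatorKernelProofs
import Literature.Analysis.Complex.StripResidueFormula
import HarnessLib

/-!
# SuzukiStructureFunctionsXiStrip — `ξ` on vertical strips of arbitrary width and the line independence of
# `ϱ_ζ^{ω,ν}` (Suzuki JFA21, proof of Lemma 4.1; column DBR; RH-FREE)

LINE 1 — LABEL: RH-FREE (growth estimates for `ξ` in the half-planes of absolute convergence and their reflections,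
Stirling; no zeros, no positivity); bears_on LADDER-RH B-D → B-P(P1)/(P3) (the `ζ` instantiation of Suzuki's
data (K1): `E_ζ^{ω,ν} = 𝖥ϱ_ζ^{ω,ν}`). WHAT THIS IS NOT: not progress toward RH; nothing here bears on the truth of RH.

Source: M. Suzuki, J. Funct. Anal. 281 (2021) 109116 = arXiv:1606.05726 [Suzuki2021Hamiltonians], Lemma 4.1 and
its proof («`ξ_L(s)` decays faster than `|s|^{−n}` … in any vertical strip of finite width. Hence `ϱ_L^{ω,ν}` is
defined by (4.1) independent of `c`»); Lagarias–Montague 2011 Lemma 3.3 (1) (tree).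

Contents (seat rh-dbr-eng-5 g7):
* `norm_riemannXi_le_of_half_le_re_wide`, **`norm_riemannXi_le_of_mem_wide_strip`** — for every `N`,
  `‖ξ(s)‖ ≤ C_N (1+|Im s|)^{N+3} e^{−π|Im s|/4}` on `−(2N+1) ≤ Re s ≤ 2(N+1)`, `|Im s| ≥ 2` (LM Lemma 3.3 (1) on
  `[½,2]`, `norm_riemannXi_le_pow_mul_exp` on `[2,2(N+1)]`, `ξ(1−s) = ξ(s)`, `‖ξ(s̄)‖ = ‖ξ(s)‖`);
* **`exists_norm_suzukiE_strip_le`** — `‖E_ζ^{ω,ν}(u+iy)‖ ≤ D e^{−π|u|/8}` uniformly on every horizontal strip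
  `a ≤ y ≤ b` (`ν ≥ 1`); `differentiable_suzukiE`; `integrable_suzukiE_lineIntegrand`;
* **`invFourierLine_suzukiE_eq`** — the defining integral (4.1) of `ϱ_ζ^{ω,ν}` does not depend on the line
  (`invFourierLine E a x = invFourierLine E b x` for all real `a, b`; Cauchy on rectangles via the tree's
  `integral_line_eq_of_differentiableOn_strip`).
-/

noncomputable section

-- D-0017: `Summit.<S>.<S>.…` is the designed namespace of a single-problem summit.
set_option linter.dupNamespace false

open MeasureTheory Set Complex Filter Topology
open scoped ComplexConjugate

namespace Summit.RiemannHypothesis.RiemannHypothesis.Theorems.SuzukiStructureFunctions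

open Literature.NumberTheory.LFunctions Literature.NumberTheory.LFunctions.SuzukiStructure
open scoped Real

/-! ## §11 `ξ` on vertical strips of arbitrary width; `E_ζ^{ω,ν}` on horizontal strips

Lemma 4.1 of Suzuki JFA21 rests on «`ξ_L(s)` decays faster than `|s|^{−n}` for any `n` in any vertical
strip of finite width». For `ζ` the tree holds the exponential decay on `½ ≤ Re s ≤ 2` (Lagarias–Montague
Lemma 3.3 (1), `norm_riemannXi_le_of_mem_strip_LM_holds`) and on `2 ≤ Re s ≤ 2(N+1)`
(`norm_riemannXi_le_pow_mul_exp`); with `ξ(1−s) = ξ(s)` this gives every strip `|Re s| ≤ 2N+1`, and hence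
a uniform bound `‖E_ζ^{ω,ν}(u+iy)‖ ≤ D e^{−π|u|/8}` on every horizontal strip `a ≤ y ≤ b` (`ν ≥ 1`). -/

/-- RH-FREE. Polynomial versus exponential: `(1+|u|)^k e^{−π|u|/4} ≤ k!(8/π)^k e^{π/8} · e^{−π|u|/8}`. -/
theorem one_add_abs_pow_mul_exp_le (k : ℕ) (u : ℝ) :
    (1 + |u|) ^ k * Real.exp (-(π / 4) * |u|) ≤
      (k.factorial * (8 / π) ^ k * Real.exp (π / 8)) * Real.exp (-(π / 8) * |u|) := by
  have hπ := Real.pi_pos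
  set X : ℝ := π / 8 * (1 + |u|) with hX
  have hX0 : 0 ≤ X := by positivity
  have hk : (0 : ℝ) < k.factorial := by positivity
  have h1 : X ^ k / k.factorial ≤ Real.exp X := Real.pow_div_factorial_le_exp X hX0 k
  have h2 : X ^ k ≤ k.factorial * Real.exp X := by
    rw [div_le_iff₀ hk] at h1; linarith
  have h3 : (1 + |u|) ^ k = (8 / π) ^ k * X ^ k := by
    rw [← mul_pow]; congr 1; rw [hX]; field_simp
  have h4 : Real.exp X = Real.exp (π / 8) * Real.exp (π / 8 * |u|) := by
    rw [← Real.exp_add]; congr 1; rw [hX]; ring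
  calc (1 + |u|) ^ k * Real.exp (-(π / 4) * |u|)
      = (8 / π) ^ k * X ^ k * Real.exp (-(π / 4) * |u|) := by rw [h3]
    _ ≤ (8 / π) ^ k * (k.factorial * Real.exp X) * Real.exp (-(π / 4) * |u|) := by gcongr
    _ = (k.factorial * (8 / π) ^ k * Real.exp (π / 8)) * (Real.exp (π / 8 * |u|) * Real.exp (-(π / 4) * |u|)) := by
        rw [h4]; ring
    _ = (k.factorial * (8 / π) ^ k * Real.exp (π / 8)) * Real.exp (-(π / 8) * |u|) := by
        rw [← Real.exp_add]; congr 1; ring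

/-- RH-FREE. `‖ξ(conj s)‖ = ‖ξ(s)‖` (Schwarz reflection). -/
theorem norm_riemannXi_conj (s : ℂ) : ‖riemannXi (conj s)‖ = ‖riemannXi s‖ := by
  rw [riemannXi_conj_holds s, Complex.norm_conj]

/-- RH-FREE. **`ξ` on the right half of a wide strip:** for every `N` there is `C > 0` with
`‖ξ(s)‖ ≤ C(1+|Im s|)^{N+3} e^{−π|Im s|/4}` whenever `½ ≤ Re s ≤ 2(N+1)` and `|Im s| ≥ 2`
(Lagarias–Montague Lemma 3.3 (1) on `[½,2]`, Stirling-order bound on `[2, 2(N+1)]`). -/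
theorem norm_riemannXi_le_of_half_le_re_wide (N : ℕ) :
    ∃ C : ℝ, 0 < C ∧ ∀ s : ℂ, 1 / 2 ≤ s.re → s.re ≤ 2 * (N + 1) → 2 ≤ |s.im| →
      ‖riemannXi s‖ ≤ C * (1 + |s.im|) ^ (N + 3) * Real.exp (-(π / 4) * |s.im|) := by
  have hπ := Real.pi_pos
  obtain ⟨C₁, hC₁, hLM⟩ := norm_riemannXi_le_of_mem_strip_LM_holds
  set C : ℝ := max C₁ (16 * π ^ 2 * (3 * N + 3) ^ (N + 3)) with hC
  have hCpos : 0 < C := lt_max_of_lt_left hC₁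
  -- the bound for `Im s ≥ 2`
  have key : ∀ s : ℂ, 1 / 2 ≤ s.re → s.re ≤ 2 * (N + 1) → 2 ≤ s.im →
      ‖riemannXi s‖ ≤ C * (1 + |s.im|) ^ (N + 3) * Real.exp (-(π / 4) * |s.im|) := by
    intro s h1 h2 ht
    have him0 : 0 ≤ s.im := by linarith
    rw [abs_of_nonneg him0]
    rcases le_or_gt s.re 2 with hs2 | hs2
    · have h := hLM s h1 hs2
      rw [abs_of_nonneg him0] at h
      have hp : (s.im + 1) ^ (5 / 2 : ℝ) ≤ (1 + s.im) ^ (N + 3) := by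
        rw [add_comm, ← Real.rpow_natCast]
        exact Real.rpow_le_rpow_of_exponent_le (by linarith) (by push_cast; linarith)
      calc ‖riemannXi s‖ ≤ C₁ * Real.exp (-(π / 4) * s.im) * (s.im + 1) ^ (5 / 2 : ℝ) := h
        _ ≤ C * Real.exp (-(π / 4) * s.im) * (1 + s.im) ^ (N + 3) := by
            gcongr; exact le_max_left _ _
        _ = C * (1 + s.im) ^ (N + 3) * Real.exp (-(π / 4) * s.im) := by ring
    · have h := norm_riemannXi_le_pow_mul_exp N (x := s.re) (t := s.im) hs2.le h2 ht
      rw [Complex.re_add_im] at h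
      have hbase : s.re + s.im + N ≤ (3 * N + 3) * (1 + s.im) := by nlinarith
      have hbase0 : 0 ≤ s.re + s.im + N := by positivity
      have hpow : (s.re + s.im + N) ^ (N + 3) ≤ ((3 * N + 3) * (1 + s.im)) ^ (N + 3) :=
        pow_le_pow_left₀ hbase0 hbase _
      calc ‖riemannXi s‖ ≤ 16 * π ^ 2 * (s.re + s.im + N) ^ (N + 3) * Real.exp (-(π / 4) * s.im) := h
        _ ≤ 16 * π ^ 2 * ((3 * N + 3) * (1 + s.im)) ^ (N + 3) * Real.exp (-(π / 4) * s.im) := by gcongr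
        _ = (16 * π ^ 2 * (3 * N + 3) ^ (N + 3)) * (1 + s.im) ^ (N + 3) * Real.exp (-(π / 4) * s.im) := by
            rw [mul_pow]; ring
        _ ≤ C * (1 + s.im) ^ (N + 3) * Real.exp (-(π / 4) * s.im) := by
            gcongr; exact le_max_right _ _
  refine ⟨C, hCpos, fun s h1 h2 ht => ?_⟩
  rcases le_or_gt 0 s.im with him | him
  · exact key s h1 h2 (by rwa [abs_of_nonneg him] at ht)
  · -- reflect: `‖ξ(s)‖ = ‖ξ(s̄)‖`, `Im s̄ = −Im s ≥ 2`
    have h := key (conj s) (by simpa using h1) (by simpa using h2)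
      (by rw [Complex.conj_im]; rw [abs_of_neg him] at ht; exact ht)
    rw [norm_riemannXi_conj, Complex.conj_im, abs_neg] at h
    exact h

/-- RH-FREE. **`ξ` decays like `e^{−π|Im s|/4}` on EVERY vertical strip, uniformly** («`ξ_L(s)` decays faster
than `|s|^{−n}` … in any vertical strip of finite width», proof of Lemma 4.1): for every `N` there is `C > 0`
with `‖ξ(s)‖ ≤ C(1+|Im s|)^{N+3} e^{−π|Im s|/4}` whenever `−(2N+1) ≤ Re s ≤ 2(N+1)` and `|Im s| ≥ 2`. -/
theorem norm_riemannXi_le_of_mem_wide_strip (N : ℕ) :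
    ∃ C : ℝ, 0 < C ∧ ∀ s : ℂ, -(2 * N + 1 : ℝ) ≤ s.re → s.re ≤ 2 * (N + 1) → 2 ≤ |s.im| →
      ‖riemannXi s‖ ≤ C * (1 + |s.im|) ^ (N + 3) * Real.exp (-(π / 4) * |s.im|) := by
  obtain ⟨C, hC, h⟩ := norm_riemannXi_le_of_half_le_re_wide N
  refine ⟨C, hC, fun s h1 h2 ht => ?_⟩
  rcases le_or_gt (1 / 2 : ℝ) s.re with hre | hre
  · exact h s hre h2 ht
  · have h' := h (1 - s) (by simp; linarith) (by simp; linarith) (by simpa [abs_neg] using ht)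
    rw [riemannXi_one_sub] at h'
    simpa [abs_neg] using h'

/-- RH-FREE. The argument of `ξ` in `E_ζ^{ω,ν}(u + iy)`: `½ + ω − i(u+iy) = (½ + ω + y) + (−u)i`. -/
theorem suzukiE_arg_eq (ω u y : ℝ) :
    (1 : ℂ) / 2 + (ω : ℂ) - I * ((u : ℂ) + (y : ℂ) * I) = ((1 / 2 + ω + y : ℝ) : ℂ) + ((-u : ℝ) : ℂ) * I := by
  apply Complex.ext <;> simp

/-- RH-FREE. **`E_ζ^{ω,ν}` on horizontal strips (the analytic input of Lemma 4.1):** for `ν ≥ 1` and every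
`a ≤ y ≤ b` there is `D ≥ 0` with `‖E_ζ^{ω,ν}(u+iy)‖ ≤ D e^{−π|u|/8}` for all real `u`, uniformly in `y`
(decay of `ξ` on the vertical strip `½ + ω + [a,b]`; compactness for `|u| ≤ 2`). -/
theorem exists_norm_suzukiE_strip_le (ω : ℝ) {ν : ℕ} (hν : 1 ≤ ν) (a b : ℝ) :
    ∃ D : ℝ, 0 ≤ D ∧ ∀ y : ℝ, y ∈ Icc a b → ∀ u : ℝ,
      ‖suzukiE ω ν ((u : ℂ) + (y : ℂ) * I)‖ ≤ D * Real.exp (-(π / 8) * |u|) := by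
  have hπ := Real.pi_pos
  -- width of the vertical strip of `ξ`
  set N : ℕ := ⌈|1 / 2 + ω| + |a| + |b|⌉₊ with hN
  have hσ : ∀ y : ℝ, y ∈ Icc a b → -(2 * N + 1 : ℝ) ≤ 1 / 2 + ω + y ∧ 1 / 2 + ω + y ≤ 2 * (N + 1) := by
    intro y hy
    have h1 : |1 / 2 + ω + y| ≤ |1 / 2 + ω| + |a| + |b| := by
      have := abs_add_le (1 / 2 + ω) y
      have hy' : |y| ≤ max |a| |b| := abs_le_max_abs_abs hy.1 hy.2
      have : max |a| |b| ≤ |a| + |b| := max_le (by linarith [abs_nonneg b]) (by linarith [abs_nonneg a])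
      linarith
    have h2 : |1 / 2 + ω| + |a| + |b| ≤ N := Nat.le_ceil _
    have h3 := abs_le.1 (h1.trans h2)
    constructor <;> linarith [h3.1, h3.2]
  obtain ⟨C, hC, hξ⟩ := norm_riemannXi_le_of_mem_wide_strip N
  -- compact part
  obtain ⟨M, hM⟩ := ((isCompact_Icc (a := -(2 * N + 1 : ℝ)) (b := 2 * (N + 1))).reProdIm
    (isCompact_Icc (a := (-2 : ℝ)) (b := 2))).exists_bound_of_continuousOn
    differentiable_riemannXi.continuous.continuousOn
  set M' : ℝ := max M 0 with hM'
  set A : ℝ := C * ((N + 3).factorial * (8 / π) ^ (N + 3) * Real.exp (π / 8)) with hA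
  set B : ℝ := M' * Real.exp (π / 4) with hB
  have hA0 : 0 ≤ A := by positivity
  have hAB0 : 0 ≤ max A B := le_max_of_le_left hA0
  -- scalar bound for `ξ` at the shifted argument
  have hξu : ∀ y : ℝ, y ∈ Icc a b → ∀ u : ℝ,
      ‖riemannXi (((1 / 2 + ω + y : ℝ) : ℂ) + ((-u : ℝ) : ℂ) * I)‖ ≤ max A B * Real.exp (-(π / 8) * |u|) := by
    intro y hy u
    set s : ℂ := ((1 / 2 + ω + y : ℝ) : ℂ) + ((-u : ℝ) : ℂ) * I with hs
    have hsre : s.re = 1 / 2 + ω + y := by simp [hs]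
    have hsim : s.im = -u := by simp [hs]
    obtain ⟨hσ1, hσ2⟩ := hσ y hy
    rcases le_or_gt 2 |u| with hu | hu
    · have h := hξ s (by rw [hsre]; exact hσ1) (by rw [hsre]; exact hσ2) (by rw [hsim, abs_neg]; exact hu)
      rw [hsim, abs_neg] at h
      calc ‖riemannXi s‖ ≤ C * (1 + |u|) ^ (N + 3) * Real.exp (-(π / 4) * |u|) := h
        _ = C * ((1 + |u|) ^ (N + 3) * Real.exp (-(π / 4) * |u|)) := by ring
        _ ≤ C * (((N + 3).factorial * (8 / π) ^ (N + 3) * Real.exp (π / 8)) * Real.exp (-(π / 8) * |u|)) :=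
            mul_le_mul_of_nonneg_left (one_add_abs_pow_mul_exp_le (N + 3) u) hC.le
        _ = A * Real.exp (-(π / 8) * |u|) := by rw [hA]; ring
        _ ≤ max A B * Real.exp (-(π / 8) * |u|) := by gcongr; exact le_max_left _ _
    · have hmem : s ∈ (Icc (-(2 * N + 1 : ℝ)) (2 * (N + 1))) ×ℂ (Icc (-2 : ℝ) 2) := by
        rw [Complex.mem_reProdIm, hsre, hsim]
        exact ⟨⟨hσ1, hσ2⟩, ⟨by linarith [(abs_lt.1 hu).1, (abs_lt.1 hu).2], by
          linarith [(abs_lt.1 hu).1, (abs_lt.1 hu).2]⟩⟩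
      have h := (hM s hmem).trans (le_max_left M 0)
      have hexp : 1 ≤ Real.exp (π / 4) * Real.exp (-(π / 8) * |u|) := by
        rw [← Real.exp_add]
        exact Real.one_le_exp (by nlinarith [abs_nonneg u])
      calc ‖riemannXi s‖ ≤ M' := h
        _ ≤ M' * (Real.exp (π / 4) * Real.exp (-(π / 8) * |u|)) :=
            le_mul_of_one_le_right (le_max_right _ _) hexp
        _ = B * Real.exp (-(π / 8) * |u|) := by rw [hB]; ring
        _ ≤ max A B * Real.exp (-(π / 8) * |u|) := by gcongr; exact le_max_right _ _
  refine ⟨(max A B) ^ ν, pow_nonneg hAB0 _, fun y hy u => ?_⟩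
  rw [suzukiE, norm_pow, suzukiE_arg_eq]
  have hex1 : Real.exp (-(π / 8) * |u|) ≤ 1 := Real.exp_le_one_iff.2 (by nlinarith [abs_nonneg u])
  calc ‖riemannXi (((1 / 2 + ω + y : ℝ) : ℂ) + ((-u : ℝ) : ℂ) * I)‖ ^ ν
      ≤ (max A B * Real.exp (-(π / 8) * |u|)) ^ ν := pow_le_pow_left₀ (norm_nonneg _) (hξu y hy u) ν
    _ = (max A B) ^ ν * (Real.exp (-(π / 8) * |u|)) ^ ν := mul_pow _ _ _
    _ ≤ (max A B) ^ ν * Real.exp (-(π / 8) * |u|) := by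
        gcongr
        calc (Real.exp (-(π / 8) * |u|)) ^ ν ≤ (Real.exp (-(π / 8) * |u|)) ^ 1 :=
              pow_le_pow_of_le_one (Real.exp_pos _).le hex1 hν
          _ = Real.exp (-(π / 8) * |u|) := pow_one _

/-- RH-FREE. `E_ζ^{ω,ν}` is entire. -/
theorem differentiable_suzukiE (ω : ℝ) (ν : ℕ) : Differentiable ℂ (suzukiE ω ν) := by
  have e : suzukiE ω ν = fun z => riemannXi (1 / 2 + ω - I * z) ^ ν := by funext z; rfl
  rw [e]
  exact ((differentiable_riemannXi.comp (by fun_prop : Differentiable ℂ fun z : ℂ => 1 / 2 + ω - I * z)).pow ν)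

/-- RH-FREE. `‖e^{−i(u+iy)x}‖ = e^{yx}`. -/
theorem norm_cexp_neg_I_line (u y x : ℝ) :
    ‖cexp (-I * ((u : ℂ) + (y : ℂ) * I) * (x : ℂ))‖ = Real.exp (y * x) := by
  rw [Complex.norm_exp]
  congr 1
  simp only [Complex.mul_re, Complex.mul_im, Complex.neg_re, Complex.neg_im, Complex.add_re,
    Complex.add_im, Complex.I_re, Complex.I_im, Complex.ofReal_re, Complex.ofReal_im]
  ring

/-- RH-FREE. **The inverse-Fourier integrand of `E_ζ^{ω,ν}` is integrable on every horizontal line** (`ν ≥ 1`):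
`u ↦ E(u+iy)e^{−i(u+iy)x} ∈ L¹(ℝ)` for all real `y`, `x`. -/
theorem integrable_suzukiE_lineIntegrand (ω : ℝ) {ν : ℕ} (hν : 1 ≤ ν) (y x : ℝ) :
    Integrable fun u : ℝ => suzukiE ω ν ((u : ℂ) + (y : ℂ) * I) * cexp (-I * ((u : ℂ) + (y : ℂ) * I) * (x : ℂ)) := by
  obtain ⟨D, hD0, hD⟩ := exists_norm_suzukiE_strip_le ω hν y y
  have hcont : Continuous fun u : ℝ =>
      suzukiE ω ν ((u : ℂ) + (y : ℂ) * I) * cexp (-I * ((u : ℂ) + (y : ℂ) * I) * (x : ℂ)) :=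
    ((differentiable_suzukiE ω ν).continuous.comp (by fun_prop)).mul (by fun_prop)
  refine Integrable.mono'
    ((Literature.Analysis.Complex.integrable_exp_neg_mul_abs (by positivity : (0:ℝ) < π / 8)).const_mul
      (D * Real.exp (y * x)))
    hcont.aestronglyMeasurable (Eventually.of_forall fun u => ?_)
  rw [norm_mul, norm_cexp_neg_I_line]
  calc ‖suzukiE ω ν ((u : ℂ) + (y : ℂ) * I)‖ * Real.exp (y * x)
      ≤ D * Real.exp (-(π / 8) * |u|) * Real.exp (y * x) :=
        mul_le_mul_of_nonneg_right (hD y ⟨le_rfl, le_rfl⟩ u) (Real.exp_pos _).le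
    _ = D * Real.exp (y * x) * Real.exp (-(π / 8) * |u|) := by ring

/-- RH-FREE. **`ϱ_ζ^{ω,ν}` does not depend on the line of integration** («`ϱ_L^{ω,ν}` is defined by (4.1)
independent of `c`», proof of Lemma 4.1): `invFourierLine E a x = invFourierLine E b x` for all real `a, b`
(Cauchy on rectangles; the vertical sides vanish by the strip decay of `E`). -/
theorem invFourierLine_suzukiE_eq (ω : ℝ) {ν : ℕ} (hν : 1 ≤ ν) (a b x : ℝ) :
    invFourierLine (suzukiE ω ν) a x = invFourierLine (suzukiE ω ν) b x := by
  wlog hab : a ≤ b generalizing a b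
  · exact (this b a (le_of_not_ge hab)).symm
  obtain ⟨D, hD0, hD⟩ := exists_norm_suzukiE_strip_le ω hν a b
  unfold invFourierLine
  congr 1
  set g : ℂ → ℂ := fun z => suzukiE ω ν z * cexp (-I * z * (x : ℂ)) with hg
  have key := integral_line_eq_of_differentiableOn_strip (g := g) hab ?_ ?_ ?_
    (h := fun R => D * Real.exp (max (a * x) (b * x)) * Real.exp (-(π / 8) * R)) ?_ ?_
  · simpa [hg] using key
  · intro z _
    exact (((differentiable_suzukiE ω ν) z).mul (by fun_prop)).differentiableWithinAt
  · exact integrable_suzukiE_lineIntegrand ω hν a x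
  · exact integrable_suzukiE_lineIntegrand ω hν b x
  · intro R y hy
    have h1 := hD y hy R
    have h2 : ‖cexp (-I * ((R : ℂ) + (y : ℂ) * I) * (x : ℂ))‖ ≤ Real.exp (max (a * x) (b * x)) := by
      rw [norm_cexp_neg_I_line, Real.exp_le_exp]
      rcases le_or_gt 0 x with hx | hx
      · exact le_trans (mul_le_mul_of_nonneg_right hy.2 hx) (le_max_right _ _)
      · exact le_trans (mul_le_mul_of_nonpos_right hy.1 hx.le) (le_max_left _ _)
    calc ‖g ((R : ℂ) + (y : ℂ) * I)‖
        = ‖suzukiE ω ν ((R : ℂ) + (y : ℂ) * I)‖ * ‖cexp (-I * ((R : ℂ) + (y : ℂ) * I) * (x : ℂ))‖ := by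
          rw [hg]; exact norm_mul _ _
      _ ≤ D * Real.exp (-(π / 8) * |R|) * Real.exp (max (a * x) (b * x)) :=
          mul_le_mul h1 h2 (norm_nonneg _) (by positivity)
      _ = D * Real.exp (max (a * x) (b * x)) * Real.exp (-(π / 8) * |R|) := by ring
  · have h1 : Tendsto (fun R : ℝ => Real.exp (-(π / 8) * R)) atTop (𝓝 0) := by
      have : Tendsto (fun R : ℝ => -(π / 8) * R) atTop atBot :=
        tendsto_id.const_mul_atTop_of_neg (by linarith [Real.pi_pos])
      exact Real.tendsto_exp_atBot.comp this
    have := h1.const_mul (D * Real.exp (max (a * x) (b * x)))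
    simpa using this

end Summit.RiemannHypothesis.RiemannHypothesis.Theorems.SuzukiStructureFunctions

end
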